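import Literature.MathematicalPhysics.QuantumFieldTheory.Balaban1983to89.B9Thm311SmallFieldPathZdContinuity
import Literature.MathematicalPhysics.QuantumFieldTheory.Balaban1983to89.B9Thm311PerMemberCubeZdTouching
import Literature.MathematicalPhysics.QuantumFieldTheory.Balaban1983to89.B9Thm311CoerciveCompactZd
import Literature.MathematicalPhysics.QuantumFieldTheory.Balaban1983to89.B9SupplySockB9P3ZdAtHermInAk

/-!
# `Balaban1983to89.B9Thm311TouchingClassOfCoerciveZd` — [Balaban1985BackgroundPropagators] Thm 3.11 p. 416 AT THE `ℤᵈ × 𝔸` CARRIER: THE CONTINUITY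
# METHOD'S REACH ON PRINT'S LOCAL SMALL-FIELD CLASS, WITH AN EXPLICIT WINDOW — uniform coercivity at the positive points of the uniform `δ`-ball
# (`4δ < (α_Q∕L²)L^{−2m}`) ⟹ the genuine `Δ_a(U₀)` is positive definite on `E_𝔤(□₀)` AND `G_𝔤(U₀)` exists for EVERY unitary `U₀` whose plaquettes
# TOUCHING `□₀` are `α`-close to `1`, for every `α` with `(|□₀|₁ + 1)·α < δ`; no preconnectedness of the regime `𝒰′` is needed

statement-level skeleton of published theorems with citation tags; proofs where landed; nothing here is a claim about the
Yang–Mills mass gap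

T. Bałaban, *Propagators for lattice gauge theories in a background field*, Commun. Math. Phys. **99** (1985) 389–434 [`Balaban1985BackgroundPropagators`,
"B9"], journal page = PDF page + 388: p. 416 Theorem 3.11 and its proof (flat positivity + perturbation; the a-priori bound (3.115) p. 418), p. 396
(3.34)–(3.36) (gauge covariance; *«there exists a gauge transformation u defined on □ … such that U^u = e^{iηA} and |A| < O(1)Mα₀»*).  T. Bałaban,
*Regular spaces …* CMP **99** (1985) 75–102 [`Balaban1985RegularSpaces`, "B8"] p. 77 (the class (1.7), the TOUCHING convention «p ∈ Ω»), Lemma 1 p. 79 (the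
axial gauge on a box).  PDF held: `paper:balaban1985-cmp99-background-propagators` pp. 396, 416–418.

CITATION HEADER ∕ WHY THIS FILE (cell `pub-ymgap`, HUMAN RULING D-0062 ∕ D-0149; width seat `pub-ymgap-dag-n06-w3` (g4), node N06 = [B9]; CLAIM-3; count-neutral).
dag-n06-w4 g3's continuity-method reduction (`B9Thm311ContinuityMethodZd`, p614111) displays (a) a uniform coercivity constant and (b) a preconnected family
inside the regime `𝒰′` — and (b) for `𝒰′` itself is OPEN (this seat's LOCATED note in `B9Thm311SmallFieldPathZd`).  THIS FILE shows that (b) is NOT needed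
for print's LOCAL class: by dag-n05-w3's layer gauge (`B8LayerAxialGauge.exists_layerGauge`: after a unitary gauge the bonds on the sides of the plaquettes
touching the box are `(|hi − lo|₁ + 1)·α`-close to `1`), the cut-off of `U₀^u` to those sides lies in the uniform `δ`-ball (this seat's CLAIM-1 runs the
reduction there: `B9Thm311SmallFieldPathZdContinuity.bondPair_pos_on_ball_of_coercive` ∕ `regularAtH_on_ball_of_coercive`), positivity and regularity pass
back along the orbit by this seat's g3 box-clause covariance (`B9Eq334GaugeCovarianceZdHerm.posDefH_opsAllZd_gaugeAct`, `regularAtH_opsAllZd_gaugeAct_iff`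
at `hbox0_cubeLamBP_of_eq`), and from the cut-off to `U₀` by dag-n06-b g20's sides locality (`B9Eq326DeltaALocalityZdSides.regular_opsAllZd_congr_cube_sides`).
dag-n06-b g20's `B9Thm311PerMemberCubeZdTouching` proves the UNCONDITIONAL statement with an `∃ α > 0` (member-dependent, from the `∃`-radius ball); the
statements here are CONDITIONAL on the displayed coercivity but their window is EXPLICIT: `α < δ ∕ (|□₀|₁ + 1)`, any `δ` with `4δ < (α_Q∕L²)L^{−2m}`.
§1 re-runs their schema `of_touching_plaquettes_unitary` with the radius displayed (credit: dag-n06-b g20; dag-n05-w3 g3 for the layer gauge).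

WHAT IS PROVED (kernel, 0 sorry; theorems only — no `def`, `instance`, `notation`).
* §1 ★★ `of_touching_plaquettes_unitary_explicit` — for a property `P` of bond fields with (B) `P` on the OPEN uniform `δ`-ball of unitary fields, (G) `P V →
  P (V^u)` for unitary `u, V`, (L) `P` reads only `SideTouches {InBox lo hi}` among unitary fields: every unitary `U` whose plaquettes touching the box are
  `α`-close to `1` has `P`, for EVERY `α ≥ 0` with `(|hi − lo|₁ + 1)·α < δ`.
* §2 (cube members: `Ω = cubeFam false …`, `Λs = cubeLamS …`, class `cubeLamBP`, `m ≤ k`, `2 ≤ d`, `2 ≤ L ≤ ρ`; `τ` faithful Hermitian tracial)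
  ★★★ `posDefH_regularAtH_of_plaqTouches_of_coercive` — `0 < δ`, `4δ < (α_Q∕L²)L^{−2m}`, uniform coercivity `c·⟨A, A⟩_τ ≤ ⟨A, Δ_a(U₀)A⟩_τ` at the positive
  points of the `δ`-ball ⟹ for every `α` with `(|□₀|₁ + 1)·α < δ` and every unitary `U₀` with touching plaquettes `α`-close to `1`: `Δ_a(U₀)` is positive
  definite on `E_𝔤(□₀)` AND `RegularAtH` (`G_𝔤(U₀)` exists); `posDefH_of_plaqTouches_of_coercive`, `regularAtH_of_plaqTouches_of_coercive` (the two halves);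
  ★★ `posDefH_regularAtH_of_inAk_of_coercive` (the datum's currency (1.7): `InAk L m i.η α₀ i.Ω U₀`, `(|□₀|₁ + 1)·α₀ < δ`).
* §3 (A6 ∕ NON-VACUITY of §2's displayed hypothesis) ★ `exists_window_coercive` — at every cube member THERE IS `δ > 0` below the window AND `c > 0` with the
  displayed coercivity on the WHOLE `δ`-ball (dag-n06-w4 g4's compactness constant `B9Thm311CoerciveCompactZd.exists_coercive_closedBall_one_cube`, shrunk below
  the window); ★★ `exists_alpha_posDefH_regularAtH_of_plaqTouches` — hence UNCONDITIONALLY `∃ α > 0` (member-dependent) with Theorem 3.11 on the local class: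
  dag-n06-b g20's `regularAtH_of_plaqTouches_cube` ∕ `posDefH_of_plaqTouches_cube` re-derived along the continuity road (a cross-check, not a new fact).
* §4 (the junction's (3.27) binder, EDITION H·I of dag-n06-b g20 `B9SupplySockB9P3ZdAtHermInAk.InvAtHI`) ★★★ `invAtHI_withGopZdH_of_coercive` — given the
  displayed coercivity on the `δ`-ball, `InvAtHI L (withGopZdH (opsAllZd …)) aI M i m` holds for EVERY `aI ≥ 0` with `(|□₀|₁ + 1)·aI < δ` (explicit threshold;
  dag-n06-b's `B9Thm311InvAtHIWitnessCubeZd.invAtHI_withGopZdH_opsAllZd_cube` has `∃ aI > 0` unconditionally).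

HONEST SCOPE.  By-name composition; CONDITIONAL on the displayed coercivity (print's (3.115)-type bound — N06's object-bound, NOT proved); the window is
explicit but MEMBER-DEPENDENT through `|□₀|₁ = l1(sqHi − sqLo)` (print's uniform `α₀′`, `M₀` are not reached); no estimate of [B9]; count-neutral helper;
N05 ∕ N06 NOT discharged; K1⁸ `stmt-QuantumFields-26907` NOT closed; one finite `𝕋⁴` programme at fixed `ε`, Bałaban as printed; R4 closes only the conditional
finite-`𝕋⁴` rung `BalabanLadder.UV` — nothing continuum ∕ ℝ⁴ ∕ OS ∕ mass gap ∕ Clay.  Unit `pub-ymgap-dag-n06-w3` (g4), 2026-08-28.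
-/

noncomputable section

namespace Literature.MathematicalPhysics.QuantumFieldTheory.Balaban1983to89.B9Thm311TouchingClassOfCoerciveZd

open B7Prop1Explicit
open B7Prop1Local (InBox)
open B7Prop2Explicit (unitaryUnits mem_unitaryUnits unitaryUnits_le_U1)
open B8Ineq132 (plaqF PlaqTouches InAk)
open B8Eq140Level (SideTouches)
open B8Eq131Cubes (cube sqLo sqHi)
open B8Eq131CubesAdmissible (cubeFam cubeFam_false_zero)
open B8CubeMemberZd (cubeLamS)
open B8Ineq159FlatCubeMemberPrinted (cubeLamBP)
open B8Ineq159FlatCubeMemberKernel (mem_cube_zero_iff)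
open B8LeafModelZd (ZdIdx)
open B8Eq115GaugeFixing (gaugeAct_mem_of)
open B8LayerAxialGauge (exists_layerGauge)
open B9SupplySockB9P3ZdLetters (OpsZd deltaAOf)
open B9SupplySockB9P3ZdAllLettersZd (opsAllZd)
open B9Eq327GreenZd (domSub bondPair)
open B9Eq327GreenZdHerm (domSubH domSubH_le RegularAtH withGopZdH withGopZdH_Gop deltaAOf_withGopZdH gopZdH_apply_eq_of_regularAtH)
open B9SupplySockB9P3ZdAtHermInAk (InvAtHI invAtHI_of_forall)
open B9Eq333ProjectionCovarianceZd (gaugeAct_inv_gaugeAct inv_mem_unitaryUnits)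
open B9Eq316AveragingTransposeZd (Reg17 alphaQ alphaQ_pos)
open B9Eq316AveragingTransposeZdLevelZero (hbox0_cubeLamBP_of_eq)
open B9Eq326DeltaALocalityZdSides (regular_opsAllZd_congr_cube_sides)
open B9Thm311PerMemberCubeZdTouching (sqLo_le_sqHi_zero plaq_le_of_inAk)
open B9Thm311SmallFieldPathZdContinuity (bondPair_pos_on_ball_of_coercive regularAtH_on_ball_of_coercive)
open B9Thm311CoerciveCompactZd (exists_coercive_closedBall_one_cube)

-- `Site` alone could resolve to the torus sites of `Setup.lean`; re-export the `ℤ^d` sites of `B7Prop1Explicit`.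
export B7Prop1Explicit (Site)

variable {d : ℕ} {𝔸 : Type*} [CStarAlgebra 𝔸] [Nontrivial 𝔸]

/-! ## §1  The layer-gauge transfer schema with the radius displayed -/

section Schema

/-- ★★ **THE LAYER-GAUGE TRANSFER SCHEMA, EXPLICIT WINDOW** (dag-n06-b g20's `B9Thm311PerMemberCubeZdTouching.of_touching_plaquettes_unitary` re-run with the
ball radius `δ` displayed instead of `∃`-quantified): if (B) `P V` for every unitary `V` with `sup_b ‖V(b) − 1‖ < δ`, (G) `P V → P (V^u)` for unitary `u, V`,
and (L) `P` transfers between unitary fields agreeing on `SideTouches {InBox lo hi}`, then EVERY unitary `U` whose plaquettes touching the box `[lo, hi]` are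
`α`-close to `1` has `P` — for every `α ≥ 0` with `(|hi − lo|₁ + 1)·α < δ`.  Mechanism (theirs): dag-n05-w3's layer gauge `u` (unitary) makes `U^u`
`(|hi − lo|₁ + 1)α`-close to `1` on those sides; cut `U^u` off to `1` elsewhere, apply (B), transfer by (L), undo by (G) at `u⁻¹`.
[cite: Balaban1985RegularSpaces, Lemma 1 p.79, (1.11) p.78, p.77; Balaban1985BackgroundPropagators, (3.36) p.396, Thm 3.11 p.416] -/
theorem of_touching_plaquettes_unitary_explicit {lo hi : Site d} (hlohi : ∀ i, lo i ≤ hi i) {P : (Site d → Fin d → 𝔸ˣ) → Prop} {δ : ℝ}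
    (hB : ∀ V : Site d → Fin d → 𝔸ˣ, (∀ x κ, V x κ ∈ unitaryUnits 𝔸) → (∀ x κ, ‖((V x κ : 𝔸ˣ) : 𝔸) - 1‖ < δ) → P V)
    (hG : ∀ (u : Site d → 𝔸ˣ) (V : Site d → Fin d → 𝔸ˣ), (∀ x, u x ∈ unitaryUnits 𝔸) → (∀ x κ, V x κ ∈ unitaryUnits 𝔸) →
      P V → P (gaugeAct u V))
    (hL : ∀ (U U' : Site d → Fin d → 𝔸ˣ), (∀ x κ, U x κ ∈ unitaryUnits 𝔸) → (∀ x κ, U' x κ ∈ unitaryUnits 𝔸) →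
      (∀ (y : Site d) (τ : Fin d), SideTouches {z | InBox lo hi z} y τ → U y τ = U' y τ) → P U → P U')
    {α : ℝ} (hα : 0 ≤ α) (hαδ : ((l1 (hi - lo) : ℝ) + 1) * α < δ)
    {U : Site d → Fin d → 𝔸ˣ} (hU : ∀ x κ, U x κ ∈ unitaryUnits 𝔸)
    (hP : ∀ (z : Site d) (κ μ : Fin d), κ ≠ μ → PlaqTouches {y | InBox lo hi y} z κ μ → ‖plaqF U κ μ z - 1‖ ≤ α) : P U := by
  classical
  have hδ : 0 < δ := lt_of_le_of_lt (by positivity) hαδ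
  have hU1 : ∀ x κ, U x κ ∈ U1 𝔸 := fun x κ => unitaryUnits_le_U1 (hU x κ)
  obtain ⟨u, huH, -, hclose⟩ := exists_layerGauge hU1 hU hlohi hα hP
  -- the cut-off of `U^u` to the sides of the touching plaquettes
  obtain ⟨V, hV⟩ : ∃ V : Site d → Fin d → 𝔸ˣ,
      V = fun x κ => if SideTouches {z | InBox lo hi z} x κ then gaugeAct u U x κ else 1 := ⟨_, rfl⟩
  have hVH : ∀ x κ, V x κ ∈ unitaryUnits 𝔸 := by
    intro x κ; rw [hV]; dsimp only; split_ifs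
    · exact gaugeAct_mem_of hU huH x κ
    · exact (unitaryUnits 𝔸).one_mem
  have hVδ : ∀ x κ, ‖((V x κ : 𝔸ˣ) : 𝔸) - 1‖ < δ := by
    intro x κ; rw [hV]; dsimp only; split_ifs with hst
    · exact (hclose x κ hst).trans_lt hαδ
    · rw [Units.val_one, sub_self, norm_zero]; exact hδ
  have hPV : P V := hB V hVH hVδ
  have huU : ∀ x κ, gaugeAct u U x κ ∈ unitaryUnits 𝔸 := fun x κ => gaugeAct_mem_of hU huH x κ
  have hPuU : P (gaugeAct u U) := hL V (gaugeAct u U) hVH huU (fun y τ hst => by rw [hV]; exact if_pos hst) hPV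
  have h := hG u⁻¹ (gaugeAct u U) (inv_mem_unitaryUnits huH) huU hPuU
  rwa [gaugeAct_inv_gaugeAct] at h

end Schema

/-! ## §2  Cube members: Theorem 3.11 on the local class from the a-priori bound, explicit window -/

section Cube

variable (τ : 𝔸 →ₗ[ℂ] ℂ) [FiniteDimensional ℝ 𝔸] {L : ℕ}
  (hτp : ∀ a : 𝔸, a ≠ 0 → 0 < (τ (star a * a)).re) (hτt : ∀ a b : 𝔸, τ (a * b) = τ (b * a))
  (hτs : ∀ a : 𝔸, τ (star a) = starRingEnd ℂ (τ a))

include hτp hτt hτs in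
/-- ★★★ **THEOREM 3.11 ON PRINT'S LOCAL CLASS FROM THE A-PRIORI BOUND, EXPLICIT WINDOW.**  At a cube member (`Ω = cubeFam false L a Mc ρ k`,
`Λs = cubeLamS …`, class `cubeLamBP`, `m ≤ k`, `2 ≤ d`, `2 ≤ L ≤ ρ`; `τ` faithful Hermitian tracial on a finite-dimensional fibre), let `0 < δ` with
`4δ < (α_Q∕L²)L^{−2m}` and suppose the UNIFORM COERCIVITY `c·⟨A, A⟩_τ ≤ ⟨A, Δ_a(V)A⟩_τ` holds at the positive points `V` of the uniform `δ`-ball (print's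
(3.115)-type bound, displayed).  Then for every `α ≥ 0` with `(|□₀|₁ + 1)·α < δ` (`|□₀|₁ = l1 (sqHi − sqLo)`) and EVERY unitary `U₀` whose plaquettes TOUCHING
`□₀` are `α`-close to `1`: the genuine four-letter `Δ_a(U₀)` is positive definite on `E_𝔤(□₀)` AND `Δ_a(U₀)↾□₀` is invertible there (`RegularAtH`).
(B) = this seat's CLAIM-1 on the ball; (G) = this seat's g3 box-clause covariance at print's class; (L) = dag-n06-b g20's sides locality; glued by §1.
[cite: Balaban1985BackgroundPropagators, Thm 3.11 p.416, (3.115) p.418, (3.27) p.395, (3.34)–(3.36) p.396; Balaban1985RegularSpaces, (1.7) p.77, Lemma 1 p.79, (1.131) p.99] -/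
theorem posDefH_regularAtH_of_plaqTouches_of_coercive (hd2 : 2 ≤ d) (hL : 2 ≤ L) (ops₀ : ℝ → ZdIdx d L → ℕ → OpsZd d 𝔸) (M : ℝ) (i : ZdIdx d L)
    {a : Site d} {Mc ρ : ℕ} (hρ : L ≤ ρ) (hΩ : i.Ω = cubeFam false L a Mc ρ i.k) (hΛs : i.Λs = cubeLamS L a Mc ρ i.k) {m : ℕ} (hm : m ≤ i.k)
    {δ : ℝ} (hδ0 : 0 < δ) (hδ : 4 * δ < alphaQ d L / (L : ℝ) ^ 2 * (((L : ℝ) ^ m)⁻¹) ^ 2) {c : ℝ} (hc : 0 < c)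
    (hcoer : ∀ V ∈ {U : Site d → Fin d → 𝔸ˣ | (∀ x κ, U x κ ∈ unitaryUnits 𝔸) ∧ ∀ x κ, ‖((U x κ : 𝔸ˣ) : 𝔸) - 1‖ < δ},
      (∀ A ∈ domSubH (𝔸 := 𝔸) (i.Ω 0), A ≠ 0 → 0 < bondPair τ A (deltaAOf i.η (opsAllZd τ L (cubeLamBP L a Mc ρ i.k) ops₀ M i m) V A)) →
        ∀ A ∈ domSubH (𝔸 := 𝔸) (i.Ω 0), c * bondPair τ A A ≤ bondPair τ A (deltaAOf i.η (opsAllZd τ L (cubeLamBP L a Mc ρ i.k) ops₀ M i m) V A))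
    {α : ℝ} (hα : 0 ≤ α) (hαδ : ((l1 (sqHi L a Mc ρ i.k 0 - sqLo L a ρ i.k 0) : ℝ) + 1) * α < δ)
    {U₀ : Site d → Fin d → 𝔸ˣ} (hU₀ : ∀ x κ, U₀ x κ ∈ unitaryUnits 𝔸)
    (hsmall : ∀ (z : Site d) (κ μ : Fin d), κ ≠ μ → PlaqTouches (i.Ω 0) z κ μ → ‖plaqF U₀ κ μ z - 1‖ ≤ α) :
    (∀ A ∈ domSubH (𝔸 := 𝔸) (i.Ω 0), A ≠ 0 → 0 < bondPair τ A (deltaAOf i.η (opsAllZd τ L (cubeLamBP L a Mc ρ i.k) ops₀ M i m) U₀ A)) ∧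
      RegularAtH i.η (opsAllZd τ L (cubeLamBP L a Mc ρ i.k) ops₀ M i m) (i.Ω 0) U₀ := by
  haveI : NeZero L := ⟨by omega⟩
  have hL1 : 1 ≤ L := le_trans (by norm_num) hL
  have hfin : (i.Ω 0).Finite := B9Thm311PosDefOpenZd.cubeMember_Ω0_finite i hΩ
  have hset : {y : Site d | InBox (sqLo L a ρ i.k 0) (sqHi L a Mc ρ i.k 0) y} = i.Ω 0 := by
    rw [hΩ, cubeFam_false_zero]; ext y; exact (mem_cube_zero_iff L a Mc ρ i.k y).symm
  -- the box clause of print's class at the levels `≥ 1` (for the covariance of `Q*aQ` at EVERY unitary background)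
  have hbox := hbox0_cubeLamBP_of_eq hL1 i a Mc hρ hΩ hm
  -- the property: positivity on `E_𝔤(□₀)` AND regularity
  refine of_touching_plaquettes_unitary_explicit (𝔸 := 𝔸) (sqLo_le_sqHi_zero L a Mc (le_trans hL1 hρ) i.k)
    (P := fun V => (∀ A ∈ domSubH (𝔸 := 𝔸) (i.Ω 0), A ≠ 0 →
        0 < bondPair τ A (deltaAOf i.η (opsAllZd τ L (cubeLamBP L a Mc ρ i.k) ops₀ M i m) V A)) ∧
      RegularAtH i.η (opsAllZd τ L (cubeLamBP L a Mc ρ i.k) ops₀ M i m) (i.Ω 0) V)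
    (fun V hV hVδ => ?_) (fun u V hu hV hPV => ?_) (fun U U' hU hU' hag hPU => ?_) hα hαδ hU₀
    (fun z κ μ hκμ hpt => hsmall z κ μ hκμ (by rw [hset] at hpt; exact hpt))
  · -- (B): CLAIM-1 on the ball, from the displayed coercivity
    exact ⟨bondPair_pos_on_ball_of_coercive τ hτp hτt hτs hd2 hL ops₀ M i hΩ hΛs hρ hm hδ0 hδ hc hcoer V ⟨hV, hVδ⟩,
      regularAtH_on_ball_of_coercive τ hτp hτt hτs hd2 hL ops₀ M i hΩ hΛs hρ hm hδ0 hδ hc hcoer V ⟨hV, hVδ⟩⟩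
  · -- (G): along unitary gauge orbits (box-clause covariance at print's class)
    exact ⟨B9Eq334GaugeCovarianceZdHerm.posDefH_opsAllZd_gaugeAct τ L (cubeLamBP L a Mc ρ i.k) ops₀ M i m hL hbox hτt hτs hτp hV hu hfin hPV.1,
      (B9Eq334GaugeCovarianceZdHerm.regularAtH_opsAllZd_gaugeAct_iff τ L (cubeLamBP L a Mc ρ i.k) ops₀ M i m hL hbox hτt hτs hτp hV hu hfin).mpr hPV.2⟩
  · -- (L): the sides locality
    rw [hset] at hag
    have hloc := regular_opsAllZd_congr_cube_sides τ hd2 hL ops₀ M i hρ hΩ hΛs hfin hm hag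
    refine ⟨fun A hA hA0 => ?_, hloc.1.mp hPU.2⟩
    rw [← hloc.2.2.2 A (domSubH_le (i.Ω 0) hA)]
    exact hPU.1 A hA hA0

include hτp hτt hτs in
/-- the positivity half. [cite: Balaban1985BackgroundPropagators, Thm 3.11 p.416, (3.115) p.418; Balaban1985RegularSpaces, (1.7) p.77] -/
theorem posDefH_of_plaqTouches_of_coercive (hd2 : 2 ≤ d) (hL : 2 ≤ L) (ops₀ : ℝ → ZdIdx d L → ℕ → OpsZd d 𝔸) (M : ℝ) (i : ZdIdx d L)
    {a : Site d} {Mc ρ : ℕ} (hρ : L ≤ ρ) (hΩ : i.Ω = cubeFam false L a Mc ρ i.k) (hΛs : i.Λs = cubeLamS L a Mc ρ i.k) {m : ℕ} (hm : m ≤ i.k)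
    {δ : ℝ} (hδ0 : 0 < δ) (hδ : 4 * δ < alphaQ d L / (L : ℝ) ^ 2 * (((L : ℝ) ^ m)⁻¹) ^ 2) {c : ℝ} (hc : 0 < c)
    (hcoer : ∀ V ∈ {U : Site d → Fin d → 𝔸ˣ | (∀ x κ, U x κ ∈ unitaryUnits 𝔸) ∧ ∀ x κ, ‖((U x κ : 𝔸ˣ) : 𝔸) - 1‖ < δ},
      (∀ A ∈ domSubH (𝔸 := 𝔸) (i.Ω 0), A ≠ 0 → 0 < bondPair τ A (deltaAOf i.η (opsAllZd τ L (cubeLamBP L a Mc ρ i.k) ops₀ M i m) V A)) →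
        ∀ A ∈ domSubH (𝔸 := 𝔸) (i.Ω 0), c * bondPair τ A A ≤ bondPair τ A (deltaAOf i.η (opsAllZd τ L (cubeLamBP L a Mc ρ i.k) ops₀ M i m) V A))
    {α : ℝ} (hα : 0 ≤ α) (hαδ : ((l1 (sqHi L a Mc ρ i.k 0 - sqLo L a ρ i.k 0) : ℝ) + 1) * α < δ)
    {U₀ : Site d → Fin d → 𝔸ˣ} (hU₀ : ∀ x κ, U₀ x κ ∈ unitaryUnits 𝔸)
    (hsmall : ∀ (z : Site d) (κ μ : Fin d), κ ≠ μ → PlaqTouches (i.Ω 0) z κ μ → ‖plaqF U₀ κ μ z - 1‖ ≤ α) :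
    ∀ A ∈ domSubH (𝔸 := 𝔸) (i.Ω 0), A ≠ 0 → 0 < bondPair τ A (deltaAOf i.η (opsAllZd τ L (cubeLamBP L a Mc ρ i.k) ops₀ M i m) U₀ A) :=
  (posDefH_regularAtH_of_plaqTouches_of_coercive τ hτp hτt hτs hd2 hL ops₀ M i hρ hΩ hΛs hm hδ0 hδ hc hcoer hα hαδ hU₀ hsmall).1

include hτp hτt hτs in
/-- the regularity half: `G_𝔤(U₀) = (□₀Δ_a(U₀)□₀)⁻¹` exists on `E_𝔤(□₀)`. [cite: Balaban1985BackgroundPropagators, Thm 3.11 p.416, (3.27) p.395, (3.115) p.418] -/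
theorem regularAtH_of_plaqTouches_of_coercive (hd2 : 2 ≤ d) (hL : 2 ≤ L) (ops₀ : ℝ → ZdIdx d L → ℕ → OpsZd d 𝔸) (M : ℝ) (i : ZdIdx d L)
    {a : Site d} {Mc ρ : ℕ} (hρ : L ≤ ρ) (hΩ : i.Ω = cubeFam false L a Mc ρ i.k) (hΛs : i.Λs = cubeLamS L a Mc ρ i.k) {m : ℕ} (hm : m ≤ i.k)
    {δ : ℝ} (hδ0 : 0 < δ) (hδ : 4 * δ < alphaQ d L / (L : ℝ) ^ 2 * (((L : ℝ) ^ m)⁻¹) ^ 2) {c : ℝ} (hc : 0 < c)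
    (hcoer : ∀ V ∈ {U : Site d → Fin d → 𝔸ˣ | (∀ x κ, U x κ ∈ unitaryUnits 𝔸) ∧ ∀ x κ, ‖((U x κ : 𝔸ˣ) : 𝔸) - 1‖ < δ},
      (∀ A ∈ domSubH (𝔸 := 𝔸) (i.Ω 0), A ≠ 0 → 0 < bondPair τ A (deltaAOf i.η (opsAllZd τ L (cubeLamBP L a Mc ρ i.k) ops₀ M i m) V A)) →
        ∀ A ∈ domSubH (𝔸 := 𝔸) (i.Ω 0), c * bondPair τ A A ≤ bondPair τ A (deltaAOf i.η (opsAllZd τ L (cubeLamBP L a Mc ρ i.k) ops₀ M i m) V A))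
    {α : ℝ} (hα : 0 ≤ α) (hαδ : ((l1 (sqHi L a Mc ρ i.k 0 - sqLo L a ρ i.k 0) : ℝ) + 1) * α < δ)
    {U₀ : Site d → Fin d → 𝔸ˣ} (hU₀ : ∀ x κ, U₀ x κ ∈ unitaryUnits 𝔸)
    (hsmall : ∀ (z : Site d) (κ μ : Fin d), κ ≠ μ → PlaqTouches (i.Ω 0) z κ μ → ‖plaqF U₀ κ μ z - 1‖ ≤ α) :
    RegularAtH i.η (opsAllZd τ L (cubeLamBP L a Mc ρ i.k) ops₀ M i m) (i.Ω 0) U₀ :=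
  (posDefH_regularAtH_of_plaqTouches_of_coercive τ hτp hτt hτs hd2 hL ops₀ M i hρ hΩ hΛs hm hδ0 hδ hc hcoer hα hαδ hU₀ hsmall).2

include hτp hτt hτs in
/-- ★★ **THE SAME IN THE DATUM'S CURRENCY (1.7)**: a unitary background of [B8]'s class `𝔄_m({□_j}, α₀)` (`InAk L m i.η α₀ i.Ω U₀`) with
`(|□₀|₁ + 1)·α₀ < δ` has a positive definite `Δ_a(U₀)` on `E_𝔤(□₀)` and `G_𝔤(U₀)`, given the displayed coercivity on the `δ`-ball (its level-`0` clause
controls exactly the plaquettes touching `□₀`, dag-n06-b's `plaq_le_of_inAk`). [cite: Balaban1985RegularSpaces, (1.7) p.77, (1.58) p.86; Balaban1985BackgroundPropagators, Thm 3.11 p.416, (3.115) p.418] -/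
theorem posDefH_regularAtH_of_inAk_of_coercive (hd2 : 2 ≤ d) (hL : 2 ≤ L) (ops₀ : ℝ → ZdIdx d L → ℕ → OpsZd d 𝔸) (M : ℝ) (i : ZdIdx d L)
    {a : Site d} {Mc ρ : ℕ} (hρ : L ≤ ρ) (hΩ : i.Ω = cubeFam false L a Mc ρ i.k) (hΛs : i.Λs = cubeLamS L a Mc ρ i.k) {m : ℕ} (hm : m ≤ i.k)
    {δ : ℝ} (hδ0 : 0 < δ) (hδ : 4 * δ < alphaQ d L / (L : ℝ) ^ 2 * (((L : ℝ) ^ m)⁻¹) ^ 2) {c : ℝ} (hc : 0 < c)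
    (hcoer : ∀ V ∈ {U : Site d → Fin d → 𝔸ˣ | (∀ x κ, U x κ ∈ unitaryUnits 𝔸) ∧ ∀ x κ, ‖((U x κ : 𝔸ˣ) : 𝔸) - 1‖ < δ},
      (∀ A ∈ domSubH (𝔸 := 𝔸) (i.Ω 0), A ≠ 0 → 0 < bondPair τ A (deltaAOf i.η (opsAllZd τ L (cubeLamBP L a Mc ρ i.k) ops₀ M i m) V A)) →
        ∀ A ∈ domSubH (𝔸 := 𝔸) (i.Ω 0), c * bondPair τ A A ≤ bondPair τ A (deltaAOf i.η (opsAllZd τ L (cubeLamBP L a Mc ρ i.k) ops₀ M i m) V A))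
    {α₀ : ℝ} (hα₀ : 0 ≤ α₀) (hα₀δ : ((l1 (sqHi L a Mc ρ i.k 0 - sqLo L a ρ i.k 0) : ℝ) + 1) * α₀ < δ)
    {U₀ : Site d → Fin d → 𝔸ˣ} (hU₀ : ∀ x κ, U₀ x κ ∈ unitaryUnits 𝔸) (hInA : InAk L m i.η α₀ i.Ω U₀) :
    (∀ A ∈ domSubH (𝔸 := 𝔸) (i.Ω 0), A ≠ 0 → 0 < bondPair τ A (deltaAOf i.η (opsAllZd τ L (cubeLamBP L a Mc ρ i.k) ops₀ M i m) U₀ A)) ∧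
      RegularAtH i.η (opsAllZd τ L (cubeLamBP L a Mc ρ i.k) ops₀ M i m) (i.Ω 0) U₀ :=
  posDefH_regularAtH_of_plaqTouches_of_coercive τ hτp hτt hτs hd2 hL ops₀ M i hρ hΩ hΛs hm hδ0 hδ hc hcoer hα₀ hα₀δ hU₀
    (fun z κ μ hκμ hpt => plaq_le_of_inAk hInA z κ μ hκμ hpt)

include hτp hτt hτs in
/-- ★ **A6 ∕ NON-VACUITY OF THE DISPLAYED COERCIVITY AT SOME RADIUS**: at every cube member there are `δ > 0` with `4δ < (α_Q∕L²)L^{−2m}` and `c > 0` such that the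
uniform coercivity holds on the WHOLE `δ`-ball (a fortiori at its positive points) — dag-n06-w4 g4's compactness constant on a closed ball, the radius shrunk
below the window.  (At a GIVEN `δ` the hypothesis is print's (3.115) content and is NOT proved here.) [cite: Balaban1985BackgroundPropagators, Thm 3.11 p.416, (3.115) p.418, (3.36) p.396] -/
theorem exists_window_coercive (hd2 : 2 ≤ d) (hL : 2 ≤ L) (ops₀ : ℝ → ZdIdx d L → ℕ → OpsZd d 𝔸) (M : ℝ) (i : ZdIdx d L)
    {a : Site d} {Mc ρ : ℕ} (hρ : L ≤ ρ) (hΩ : i.Ω = cubeFam false L a Mc ρ i.k) (hΛs : i.Λs = cubeLamS L a Mc ρ i.k) {m : ℕ} (hm : m ≤ i.k) :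
    ∃ δ : ℝ, 0 < δ ∧ 4 * δ < alphaQ d L / (L : ℝ) ^ 2 * (((L : ℝ) ^ m)⁻¹) ^ 2 ∧ ∃ c : ℝ, 0 < c ∧
      ∀ V ∈ {U : Site d → Fin d → 𝔸ˣ | (∀ x κ, U x κ ∈ unitaryUnits 𝔸) ∧ ∀ x κ, ‖((U x κ : 𝔸ˣ) : 𝔸) - 1‖ < δ},
        (∀ A ∈ domSubH (𝔸 := 𝔸) (i.Ω 0), A ≠ 0 → 0 < bondPair τ A (deltaAOf i.η (opsAllZd τ L (cubeLamBP L a Mc ρ i.k) ops₀ M i m) V A)) →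
          ∀ A ∈ domSubH (𝔸 := 𝔸) (i.Ω 0), c * bondPair τ A A ≤ bondPair τ A (deltaAOf i.η (opsAllZd τ L (cubeLamBP L a Mc ρ i.k) ops₀ M i m) V A) := by
  have hL1 : 1 ≤ L := le_trans (by norm_num) hL
  obtain ⟨δ₁, hδ₁, c, hc, hcoer⟩ := exists_coercive_closedBall_one_cube τ hτp hτt hτs hd2 hL ops₀ M i hρ hΩ hΛs hm
  have hw : 0 < alphaQ d L / (L : ℝ) ^ 2 * (((L : ℝ) ^ m)⁻¹) ^ 2 := by
    have := alphaQ_pos d hL1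
    have hL0 : (0 : ℝ) < L := by exact_mod_cast (lt_of_lt_of_le zero_lt_one hL1)
    positivity
  refine ⟨min δ₁ (alphaQ d L / (L : ℝ) ^ 2 * (((L : ℝ) ^ m)⁻¹) ^ 2 / 8), lt_min hδ₁ (by positivity), ?_, c, hc, fun V hV _ => ?_⟩
  · have h8 := min_le_right δ₁ (alphaQ d L / (L : ℝ) ^ 2 * (((L : ℝ) ^ m)⁻¹) ^ 2 / 8)
    linarith
  · exact hcoer V hV.1 fun x κ => (hV.2 x κ).le.trans (min_le_left _ _)

include hτp hτt hτs in
/-- ★★ **HENCE, UNCONDITIONALLY, `∃ α > 0` WITH THEOREM 3.11 ON THE LOCAL CLASS** (member-dependent `α`; = dag-n06-b g20's `regularAtH_of_plaqTouches_cube` ∕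
`posDefH_of_plaqTouches_cube` re-derived along the continuity road — a cross-check of the two roads, not a new fact).
[cite: Balaban1985BackgroundPropagators, Thm 3.11 p.416, (3.36) p.396; Balaban1985RegularSpaces, (1.7) p.77, Lemma 1 p.79, (1.131) p.99] -/
theorem exists_alpha_posDefH_regularAtH_of_plaqTouches (hd2 : 2 ≤ d) (hL : 2 ≤ L) (ops₀ : ℝ → ZdIdx d L → ℕ → OpsZd d 𝔸) (M : ℝ) (i : ZdIdx d L)
    {a : Site d} {Mc ρ : ℕ} (hρ : L ≤ ρ) (hΩ : i.Ω = cubeFam false L a Mc ρ i.k) (hΛs : i.Λs = cubeLamS L a Mc ρ i.k) {m : ℕ} (hm : m ≤ i.k) :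
    ∃ α : ℝ, 0 < α ∧ ∀ U₀ : Site d → Fin d → 𝔸ˣ, (∀ x κ, U₀ x κ ∈ unitaryUnits 𝔸) →
      (∀ (z : Site d) (κ μ : Fin d), κ ≠ μ → PlaqTouches (i.Ω 0) z κ μ → ‖plaqF U₀ κ μ z - 1‖ ≤ α) →
        (∀ A ∈ domSubH (𝔸 := 𝔸) (i.Ω 0), A ≠ 0 → 0 < bondPair τ A (deltaAOf i.η (opsAllZd τ L (cubeLamBP L a Mc ρ i.k) ops₀ M i m) U₀ A)) ∧
          RegularAtH i.η (opsAllZd τ L (cubeLamBP L a Mc ρ i.k) ops₀ M i m) (i.Ω 0) U₀ := by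
  obtain ⟨δ, hδ0, hδ, c, hc, hcoer⟩ := exists_window_coercive τ hτp hτt hτs hd2 hL ops₀ M i hρ hΩ hΛs hm
  have hN : (0 : ℝ) < (l1 (sqHi L a Mc ρ i.k 0 - sqLo L a ρ i.k 0) : ℝ) + 1 := by positivity
  refine ⟨δ / 2 / ((l1 (sqHi L a Mc ρ i.k 0 - sqLo L a ρ i.k 0) : ℝ) + 1), by positivity, fun U₀ hU₀ hsmall => ?_⟩
  refine posDefH_regularAtH_of_plaqTouches_of_coercive τ hτp hτt hτs hd2 hL ops₀ M i hρ hΩ hΛs hm hδ0 hδ hc hcoer (by positivity) ?_ hU₀ hsmall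
  rw [mul_div_cancel₀ _ hN.ne']
  linarith

include hτp hτt hτs in
/-- ★★★ **THE JUNCTION'S (3.27) BINDER FROM THE A-PRIORI BOUND, EXPLICIT THRESHOLD**: at a cube member, given the displayed coercivity on the uniform `δ`-ball
(`0 < δ`, `4δ < (α_Q∕L²)L^{−2m}`), dag-n06-b g20's binder `InvAtHI L (withGopZdH (opsAllZd …)) aI M i m` — «for every unitary datum `U₀ ∈ 𝔄_m({□_j}, α₀)`,
`α₀ ≤ aI`, every Hermitian `A ∈ E(□₀)` and every `J` agreeing with `Δ_a(U₀)A` on the bonds of `□₀`: `G_𝔤(U₀)J = A`» — holds for EVERY `aI ≥ 0` with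
`(|□₀|₁ + 1)·aI < δ` (their `invAtHI_withGopZdH_opsAllZd_cube` has `∃ aI > 0`, unconditionally). [cite: Balaban1985BackgroundPropagators, (3.27) p.395, Thm 3.11 p.416, (3.115) p.418; Balaban1985RegularSpaces, (1.58) p.86, (1.7) p.77] -/
theorem invAtHI_withGopZdH_of_coercive (hd2 : 2 ≤ d) (hL : 2 ≤ L) (ops₀ : ℝ → ZdIdx d L → ℕ → OpsZd d 𝔸) (M : ℝ) (i : ZdIdx d L)
    {a : Site d} {Mc ρ : ℕ} (hρ : L ≤ ρ) (hΩ : i.Ω = cubeFam false L a Mc ρ i.k) (hΛs : i.Λs = cubeLamS L a Mc ρ i.k) {m : ℕ} (hm : m ≤ i.k)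
    {δ : ℝ} (hδ0 : 0 < δ) (hδ : 4 * δ < alphaQ d L / (L : ℝ) ^ 2 * (((L : ℝ) ^ m)⁻¹) ^ 2) {c : ℝ} (hc : 0 < c)
    (hcoer : ∀ V ∈ {U : Site d → Fin d → 𝔸ˣ | (∀ x κ, U x κ ∈ unitaryUnits 𝔸) ∧ ∀ x κ, ‖((U x κ : 𝔸ˣ) : 𝔸) - 1‖ < δ},
      (∀ A ∈ domSubH (𝔸 := 𝔸) (i.Ω 0), A ≠ 0 → 0 < bondPair τ A (deltaAOf i.η (opsAllZd τ L (cubeLamBP L a Mc ρ i.k) ops₀ M i m) V A)) →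
        ∀ A ∈ domSubH (𝔸 := 𝔸) (i.Ω 0), c * bondPair τ A A ≤ bondPair τ A (deltaAOf i.η (opsAllZd τ L (cubeLamBP L a Mc ρ i.k) ops₀ M i m) V A))
    {aI : ℝ} (haI : 0 ≤ aI) (haIδ : ((l1 (sqHi L a Mc ρ i.k 0 - sqLo L a ρ i.k 0) : ℝ) + 1) * aI < δ) :
    InvAtHI L (withGopZdH (opsAllZd τ L (cubeLamBP L a Mc ρ i.k) ops₀)) aI M i m := by
  refine invAtHI_of_forall L fun α₀ hα₀ U₀ hU₀ hIn A hA J hJ => ?_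
  have hN : (0 : ℝ) < (l1 (sqHi L a Mc ρ i.k 0 - sqLo L a ρ i.k 0) : ℝ) + 1 := by positivity
  -- `α₀` may be negative in the binder: read the level-`0` clause at the threshold `max α₀ 0 ≤ aI`
  have hreg := (posDefH_regularAtH_of_plaqTouches_of_coercive τ hτp hτt hτs hd2 hL ops₀ M i hρ hΩ hΛs hm hδ0 hδ hc hcoer (le_max_right α₀ 0)
    (lt_of_le_of_lt (mul_le_mul_of_nonneg_left (max_le hα₀ haI) hN.le) haIδ) hU₀
    (fun z κ μ hκμ hpt => (plaq_le_of_inAk hIn z κ μ hκμ hpt).trans (le_max_left _ _))).2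
  rw [withGopZdH_Gop]
  exact gopZdH_apply_eq_of_regularAtH i.η _ (i.Ω 0) U₀ hreg hA fun y μ hb => by rw [hJ y μ hb, deltaAOf_withGopZdH]

end Cube

end Literature.MathematicalPhysics.QuantumFieldTheory.Balaban1983to89.B9Thm311TouchingClassOfCoerciveZd

end
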